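import Summits.CriticalPhenomena.CardyFormulaZ2.Theorems.CardyComplexConeParafermionToSLESixFamiliesPercDomainMarkov
import Literature.Probability.Percolation.RussoFormula
import Mathlib.Probability.Martingale.OptionalSampling
import HarnessLib

/-!
# Freezing a slit expectation at a class stopping step (sure tower identity)

Crux `Summit.CriticalPhenomena.CardyFormulaZ2.Theses.CardyUniqueLimit.CardyRigidity`
(stmt-CriticalPhenomena-0746), line `crossing_martingale`, stub `stub_slitObservableApprox`,
piece (P-approx)(i)/(H7) "optional stopping" (worker A3b of lead c2; UNLANDED, rc 0).  The
variable `X` of `PercSlitObservableApprox` is the conditional crossing probability FROZEN at the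
discrete level step `ν`: `X = percSlitExpectation hD ½ ν g`.  Its slit expectation at depth `n`
is the slit expectation of `g` at depth `n ∧ ν`, SURELY (not only a.e.):

* `Freezing.measureReal_explorationCylinder_pos` — prefix events have positive `P_{1/2}`-mass
  (`2^{-#revealed free edges}`);
* `Freezing.percSlitExpectation_frozen` — for a class stopping step `ν` (`{ν ≤ m}` is a class
  event of `C_m`, bounded by `N`) and bounded strongly measurable `g`:
  `percSlitExpectation hD ½ n (ω ↦ percSlitExpectation hD ½ (ν ω) g ω) ω₀ =
   percSlitExpectation hD ½ (min n (ν ω₀)) g ω₀` for EVERY `ω₀`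
  (Doob's optional sampling `Martingale.stoppedValue_min_ae_eq_condExp` for the martingale
  `martingale_percSlitExpectation` + `condExp_explorationFiltration_ae_eq_percSlitExpectation`,
  upgraded from a.e. to everywhere because both sides are class functions of the positive-mass
  atoms `C_n(ω₀)`).
-/

noncomputable section

open MeasureTheory Set Filter
open Literature.Probability Literature.Probability.LatticeModels Literature.Probability.Percolation
open Literature.Probability.LatticeModels.DiscreteDobrushin
open Summit.CriticalPhenomena.CardyFormulaZ2.Cruxes.ParafermionToSLESixFamilies.CaratheodoryNetSlitUniformity

namespace Summit.CriticalPhenomena.CardyFormulaZ2.Cruxes.CardyRigidity.CrossingMartingale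

namespace Freezing

variable {D : DiscreteDobrushin} {hD : D.IsZdAdmissible}

/-- The revealed free edges of a prefix form a finite set. [folklore] -/
theorem finite_revealedFreeEdges (ω₀ : BondConfig (Site 2)) (n : ℕ) :
    (revealedFreeEdges hD ω₀ n).Finite :=
  ((Set.finite_Iio (min n (exitTime hD ω₀))).image (exploredEdge hD ω₀)).subset
    (by rintro e ⟨i, hi, rfl, -⟩; exact ⟨i, hi, rfl⟩)

/-- Revealed free edges are lattice edges. [folklore] -/
theorem mem_edgeSet_of_mem_revealedFreeEdges {ω₀ : BondConfig (Site 2)} {n : ℕ} {e : Sym2 (Site 2)}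
    (he : e ∈ revealedFreeEdges hD ω₀ n) : e ∈ (zdGraph 2).edgeSet := by
  obtain ⟨i, -, rfl, hf⟩ := he
  exact SimpleGraph.edgeSet_mono ((discreteDomainGraph_le_meshGraph _ _).trans (meshGraph_le_zdGraph _ _)) hf.1

/-- The prefix event is the local cylinder of `ω₀` over the revealed free edges. [folklore] -/
theorem explorationCylinder_eq_localCylinder (ω₀ : BondConfig (Site 2)) (n : ℕ) :
    explorationCylinder hD ω₀ n = localCylinder (revealedFreeEdges hD ω₀ n) ω₀ := by
  rw [explorationCylinder_eq_setOf_revealedFreeEdges]; rfl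

/-- **Prefix events have positive `P_{1/2}`-mass.** [folklore] -/
theorem measureReal_explorationCylinder_pos (ω₀ : BondConfig (Site 2)) (n : ℕ) :
    0 < (bondPercolation (zdGraph 2) half).real (explorationCylinder hD ω₀ n) := by
  classical
  have hfin := finite_revealedFreeEdges (hD := hD) ω₀ n
  rw [explorationCylinder_eq_localCylinder, ← hfin.coe_toFinset, bondPercolation,
    Russo.setBernoulli_real_localCylinder]
  refine Finset.prod_pos fun e he ↦ ?_
  have hedge : e ∈ (zdGraph 2).edgeSet := mem_edgeSet_of_mem_revealedFreeEdges (hfin.mem_toFinset.1 he)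
  by_cases heω : e ∈ ω₀
  · simp [Russo.weight, hedge, heω]
  · simp [Russo.weight, hedge, heω]; norm_num

/-- The value of a class stopping step is a class function of `C_n` below `n`:
`min n (ν ω) = min n (ν ω₀)` for `ω ∈ C_n(ω₀)`. [folklore] -/
theorem min_eq_of_mem {ν : BondConfig (Site 2) → ℕ}
    (hν : ∀ m (ω₀ ω : BondConfig (Site 2)), ω ∈ explorationCylinder hD ω₀ m → (ν ω ≤ m ↔ ν ω₀ ≤ m))
    {n : ℕ} {ω₀ ω : BondConfig (Site 2)} (hω : ω ∈ explorationCylinder hD ω₀ n) :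
    min n (ν ω) = min n (ν ω₀) := by
  have hω' : ω₀ ∈ explorationCylinder hD ω n := mem_explorationCylinder_comm hω
  by_cases h₀ : ν ω₀ ≤ n
  · have h1 : ν ω ≤ ν ω₀ :=
      (hν _ ω₀ ω (explorationCylinder_antitone ω₀ h₀ hω)).2 le_rfl
    have h2 : ν ω₀ ≤ ν ω :=
      (hν _ ω ω₀ (explorationCylinder_antitone ω (h1.trans h₀) hω')).2 le_rfl
    rw [le_antisymm h1 h2]
  · have h₁ : ¬ ν ω ≤ n := fun h ↦ h₀ ((hν n ω₀ ω hω).1 h)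
    rw [min_eq_left (not_le.1 h₀).le, min_eq_left (not_le.1 h₁).le]

/-- **Freezing at a class stopping step (sure tower identity).**  For admissible data, a bounded
strongly measurable real `g`, and a bounded class stopping step `ν` of the exploration, the slit
expectation at depth `n` of the frozen variable `ω ↦ percSlitExpectation hD ½ (ν ω) g ω` equals,
at EVERY `ω₀`, the slit expectation of `g` at depth `min n (ν ω₀)`.
[cite: DuminilCopinSmirnov2012Clay, §6.2, Lemma 6.6] -/
theorem percSlitExpectation_frozen {g : BondConfig (Site 2) → ℝ} (hg : StronglyMeasurable g) {K : ℝ}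
    (hgK : ∀ ω, ‖g ω‖ ≤ K) (ν : BondConfig (Site 2) → ℕ)
    (hν : ∀ m (ω₀ ω : BondConfig (Site 2)), ω ∈ explorationCylinder hD ω₀ m → (ν ω ≤ m ↔ ν ω₀ ≤ m))
    {N : ℕ} (hνN : ∀ ω, ν ω ≤ N) (n : ℕ) (ω₀ : BondConfig (Site 2)) :
    percSlitExpectation hD half n (fun ω ↦ percSlitExpectation hD half (ν ω) g ω) ω₀ =
      percSlitExpectation hD half (min n (ν ω₀)) g ω₀ := by
  set μ := bondPercolation (zdGraph 2) half with hμ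
  set ℱ := explorationFiltration hD with hℱ
  set M : ℕ → BondConfig (Site 2) → ℝ := fun m ↦ percSlitExpectation hD half m g with hM
  set G : BondConfig (Site 2) → ℝ := fun ω ↦ percSlitExpectation hD half (ν ω) g ω with hG
  have hMart : Martingale M ℱ μ := martingale_percSlitExpectation hD half hg hgK
  -- the stopping times
  set τ : BondConfig (Site 2) → WithTop ℕ := fun ω ↦ (ν ω : WithTop ℕ) with hτ_def
  have hτ : IsStoppingTime ℱ τ :=
    isStoppingTime_explorationFiltration_of_forall_mem fun m ω₁ ω hω ↦ by
      simp only [hτ_def]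
      exact_mod_cast hν m ω₁ ω hω
  have hτN : ∀ ω, τ ω ≤ (N : ℕ) := fun ω ↦ WithTop.coe_le_coe.2 (hνN ω)
  have hσ : IsStoppingTime ℱ fun _ ↦ (n : WithTop ℕ) := isStoppingTime_const ℱ n
  -- stopped values
  have hSVτ : stoppedValue M τ = G := by
    funext ω
    simp only [stoppedValue, hτ_def, hG]
    rfl
  have hSVmin : (stoppedValue M fun ω ↦ min (n : WithTop ℕ) (τ ω)) = fun ω ↦ M (min n (ν ω)) ω := by
    funext ω
    simp only [stoppedValue, hτ_def]
    have hmin : min (n : WithTop ℕ) (ν ω : WithTop ℕ) = ((min n (ν ω) : ℕ) : WithTop ℕ) := by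
      rcases le_total n (ν ω) with h | h
      · rw [min_eq_left h, min_eq_left (by exact_mod_cast h)]
      · rw [min_eq_right h, min_eq_right (by exact_mod_cast h)]
    rw [hmin]
    rfl
  -- optional sampling: `M_{n ∧ ν} = E[M_ν | ℱ_n]` a.e.
  haveI : SigmaFinite (μ.trim (hτ.min hσ).measurableSpace_le) := by
    haveI := isFiniteMeasure_trim (μ := μ) (hτ.min hσ).measurableSpace_le
    infer_instance
  have hOS := hMart.stoppedValue_min_ae_eq_condExp hτ hσ hτN
  rw [hSVmin, hSVτ, IsStoppingTime.measurableSpace_const] at hOS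
  -- `E[G | ℱ_n] = percSlitExpectation n G` a.e.
  have hGm : StronglyMeasurable G := by
    rw [← hSVτ]
    exact ((measurable_stoppedValue hMart.stronglyAdapted.isStronglyProgressive_of_discrete hτ).mono
      hτ.measurableSpace_le le_rfl).stronglyMeasurable
  have hGK : ∀ ω, ‖G ω‖ ≤ K := fun ω ↦ norm_percSlitExpectation_le half hgK _ _
  have hce := condExp_explorationFiltration_ae_eq_percSlitExpectation (hD := hD) half hGm hGK n
  have hae : ∀ᵐ ω ∂μ, percSlitExpectation hD half n G ω = M (min n (ν ω)) ω := by
    filter_upwards [hOS, hce] with ω h1 h2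
    exact (h1.trans h2).symm
  -- upgrade to everywhere: both sides are class functions of the positive-mass atom `C_n(ω₀)`
  by_contra hne
  have hsub : explorationCylinder hD ω₀ n ⊆ {ω | ¬ percSlitExpectation hD half n G ω = M (min n (ν ω)) ω} := by
    intro ω hω
    have h1 : percSlitExpectation hD half n G ω = percSlitExpectation hD half n G ω₀ :=
      percSlitExpectation_eq_of_mem G hω
    have h2 : M (min n (ν ω)) ω = M (min n (ν ω₀)) ω₀ := by
      simp only [hM, min_eq_of_mem hν hω]
      exact percSlitExpectation_eq_of_mem g (explorationCylinder_antitone ω₀ (min_le_left _ _) hω)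
    simp only [mem_setOf_eq, h1, h2]
    exact hne
  have h0 : μ (explorationCylinder hD ω₀ n) = 0 := measure_mono_null hsub (ae_iff.1 hae)
  have hpos := measureReal_explorationCylinder_pos (hD := hD) ω₀ n
  rw [measureReal_def, h0, ENNReal.toReal_zero] at hpos
  exact lt_irrefl _ hpos

end Freezing

/-- **Registered form** (glue `freezing_percSlitExpectation_frozen` of stmt-CriticalPhenomena-0746): the sure tower identity for
slit expectations frozen at a bounded class stopping step of the exploration. [cite: DuminilCopinSmirnov2012Clay, §6.2, Lemma 6.6] -/
theorem freezing_percSlitExpectation_frozen : ∀ {D : Literature.Probability.LatticeModels.DiscreteDobrushin} (hD : D.IsZdAdmissible) {g : Literature.Probability.Percolation.BondConfig (Literature.Probability.LatticeModels.Site 2) → ℝ}, MeasureTheory.StronglyMeasurable g → ∀ {K : ℝ}, (∀ ω, ‖g ω‖ ≤ K) → ∀ (ν : Literature.Probability.Percolation.BondConfig (Literature.Probability.LatticeModels.Site 2) → ℕ), (∀ (m : ℕ) (ω₀ ω : Literature.Probability.Percolation.BondConfig (Literature.Probability.LatticeModels.Site 2)), ω ∈ Literature.Probability.LatticeModels.DiscreteDobrushin.explorationCylinder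 hD ω₀ m → (ν ω ≤ m ↔ ν ω₀ ≤ m)) → ∀ {N : ℕ}, (∀ ω, ν ω ≤ N) → ∀ (n : ℕ) (ω₀ : Literature.Probability.Percolation.BondConfig (Literature.Probability.LatticeModels.Site 2)), Summit.CriticalPhenomena.CardyFormulaZ2.Cruxes.ParafermionToSLESixFamilies.CaratheodoryNetSlitUniformity.percSlitExpectation hD Literature.Probability.Percolation.half n (fun ω ↦ Summit.CriticalPhenomena.CardyFormulaZ2.Cruxes.ParafermionToSLESixFamilies.CaratheodoryNetSlitUniformity.percSlitExpectation hD Literature.Probability.Percolation.half (ν ω) g ω) ω₀ = Summit.CriticalPhenomena.CardyFormulaZ2.Cruxes.ParafermionToSLESixFamilies.CaratheodoryNetSlitUniformity.percSlitExpectation hD Literature.Probability.Percolation.half (min n (ν ω₀)) g ω₀ :=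
  fun hD _ hg _ hgK ν hν _ hνN n ω₀ ↦ Freezing.percSlitExpectation_frozen (hD := hD) hg hgK ν hν hνN n ω₀

end Summit.CriticalPhenomena.CardyFormulaZ2.Cruxes.CardyRigidity.CrossingMartingale

end
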